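import Summits.Ventures.CertifiedManyBodySolver.Observables.MeanFieldClassExclusionStrip
import Summits.Ventures.CertifiedManyBodySolver.Certificates.HubbardSquare_n1_upper_pb2_U8_row472
import Summits.Ventures.CertifiedManyBodySolver.Certificates.HubbardSquare_n7o8_boxword_cuprate_box3d
import Literature.MathematicalPhysics.QuantumLattice.HubbardFillingBoxEnergyBounds
import Literature.MathematicalPhysics.QuantumLattice.HubbardEnergyDensityChordBounds
import Literature.MathematicalPhysics.QuantumLattice.HubbardSquareFreeFermionEnergyDensity
import HarnessLib

/-!
# Ventures/CertifiedManyBodySolver — Observables/MeanFieldClassExclusionLaBox.lean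

HONEST FRAMING: first certified bounds; not a superconductivity verdict; every number certified or labelled float.
A competing-order EXCLUSION removes a named class of candidate ground states; it never says which order is present;
no phase sentence follows.

Cell `hubbard-tc` (MO-S3, D-0096), seat `hubbard-tc-mod-3` (G3), `prover-hubbard-tc-mod-3-g2-0`. The FILLING-THICKENED form
of `MeanFieldClassExclusionStrip.lean` (`m3Strip_docc_lt_sq_half_density_of`, the `n = 7/8` line), asked for by the cell
referee (R27: «S1 n-intervals still need your n-transport»): on the 3-D box

  `t = 1`, `t′ ∈ [−3/10, 0]`, `U ∈ [7, 15]`, `n ∈ [171/200, 179/200]`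

— which CONTAINS the `(U, t′, n)` projection of the S1 BOX OF RECORD #18 of La₂₋ₓSrₓCuO₄ at x = ⅛, OBJECT E (column M15:
`U/t_eff ∈ [7.9, 14.7]`, `t′/t_eff ∈ [−0.30, −0.20]`, `n ∈ [0.855, 0.895]`; TC-TABLE v0.7 §0), the superseded LIT-PREVIEW v1.1 hull
(`[7, 12.6] × [−0.18, −0.08] × 0.875 ± 0.01`) and the memo cuprate box `(8 ± ½, −¼ ± 1/20, ⅞ ± 1/100)` — EVERY torus
limit `ω` of unit `(rectN n L, S^z = 0)`-sector ground states of `hubbardTorusTT' L 1 t′ U` has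

  `Re ω(n_{0↑} n_{0↓}) < (n/2)²`      (`laBox_docc_lt_sq_half_density_of`),

so no such ground state is a non-magnetic quasi-free (Hartree–Fock / singlet BCS, any gap) state, for which Wick's rule
gives `docc ≥ (n/2)²` (Bach–Lieb–Solovej 1994 §2; docstring reading — the THEOREM is the strict docc inequality).

Composition of tree theorems only; the claim nodes #354 (`cert_dbt299pair_allk`), #445 (`cert_dbt329pair_allk`) and #472
(`cert_r472_pb2_tl_upper_n1_U8`, half-filling cap at `U = 8`) enter BY HYPOTHESIS. Devices: the strip cap
`strip78_cap_of_anchor` and the kernel cell-exact Fermi-sea floors (`fermiSeaCellRow_*_density_seven_div_eight`,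
`strip78_floor_between`) of the strip file; the half-filling cap carried to every `t′` by `t′`-evenness + concavity
(`box3d_halfFilling_cap_of_tp0`) and above `U = 8` by the Hartree–Fock Lipschitz constant `(1/2)²`
(`energyDensityTT'_ge_sub_mul_sq_U`); the exact free half-filled value `e(1,0,0,1) = −16/π² < −1.6211`
(`FreeFermionSquare.energyDensity2D_one_zero_one_mem_Ioo`); the filling transport of the box crew — vacuum chord /
density chord to half filling for the CAP (`energyDensityTT'_le_vacuum_chord`, `energyDensityTT'_le_density_chord`,
`energyDensityTT'_le_max_of_mem_Icc`) and `box3d_node_floor` (vacuum secant + secant to the half-filling cap) for the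
FLOOR of the free gas (`energyDensityTT'_ge_min_of_mem_Icc_left/right`, the box crew's `box3d_node_floor` re-read on the
wider band); and the docc `U`-chord between the cut `U₀ = 0` and the cap
(`IsTorusLimitOf.re_expect_docc_le_chord_of_groundState`). The conclusion is reached as
`docc ≤ (u − ℓ)/U < (171/400)² ≤ (n/2)²`; the thirty linear margins (5 `t′`-pieces × 3 cap branches × 2 `U`-regimes) are
`≥ 0.13` (exact decimal arithmetic, `linarith`). WHAT THIS IS NOT: a bound at a new anchor; a statement about stripes,
d-wave order or T_c; the saturated-FM class (its floor is one-species kinematics, not in this vocabulary); tight.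

References: T. Koma, H. Tasaki, J. Stat. Phys. 76 (1994) 745, §1 [KomaTasaki1994]; V. Bach, E. H. Lieb, J. P. Solovej,
J. Stat. Phys. 76 (1994) 3, eq. (2c.36) [BachLiebSolovej1994]; E. H. Lieb, M. Loss, Duke Math. J. 71 (1993) 337, §8 Thm 8.2
[LiebLoss1993]; R. B. Israel, Convexity in the Theory of Lattice Gases (1979), Thm I.3.4 [Israel1979]; D. Ruelle,
Statistical Mechanics (1969) §3.3 [Ruelle1969].
-/

noncomputable section

namespace Summit.Ventures.CertifiedManyBodySolver.Observables

open Literature.MathematicalPhysics.QuantumLattice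
open Literature.MathematicalPhysics.QuantumLattice.ThermodynamicLimit
open Summit.Ventures.CertifiedManyBodySolver.Certificates
open Matrix HubbardWave0 Literature.Probability.LatticeModels Filter Topology
open scoped ComplexOrder BigOperators

/-! ### §1 The half-filling caps (certified at `U = 8`, exact at `U = 0`), at every `t′` -/

/-- **Half-filling cap from CERTIFIED #472 on the whole `(t′, U)` quarter-plane `U ≥ 0`**:
`e(1, t′, U, 1) ≤ −0.5087724429 + (1/4)·max(U − 8, 0)` — #472 at `(8, 1, 0)` as a decimal, monotonicity in `U` below 8,
the Hartree–Fock Lipschitz constant `(1/2)²` above, and `t′`-evenness + concavity at half filling (zero `t′`-loss).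
[cite: Israel1979, Thm. I.3.4] [cite: Ruelle1969, §3.3] -/
theorem laBox_halfFilling_cap_of (h472 : cert_r472_pb2_tl_upper_n1_U8) (t' : ℝ) {U : ℝ} (hU : 0 ≤ U) :
    energyDensityTT' 1 t' U 1 ≤ -0.5087724429 + 1 / 4 * max (U - 8) 0 := by
  have h8 : energyDensityTT' 1 0 8 1 ≤ -0.5087724429 := by
    have h := m2_U8_upper_r472_of h472
    unfold M2EnergyUpperRow at h
    rw [energyDensityTT'_zero]
    refine h.trans ?_
    push_cast
    norm_num
  have h0 : energyDensityTT' 1 0 U 1 ≤ -0.5087724429 + 1 / 4 * max (U - 8) 0 := by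
    rcases le_total U 8 with hle | hle
    · have hm := energyDensityTT'_mono_U 1 0 (n := 1) (by norm_num) (by norm_num) hU hle
      have hz : (0 : ℝ) ≤ 1 / 4 * max (U - 8) 0 := by positivity
      linarith
    · have hq := energyDensityTT'_ge_sub_mul_sq_U 1 0 (n := 1) (by norm_num) (by norm_num)
        (by norm_num : (0 : ℝ) ≤ 8) hle
      rw [max_eq_left (by linarith : (0 : ℝ) ≤ U - 8)]
      norm_num at hq
      linarith
  exact box3d_halfFilling_cap_of_tp0 hU h0 t'

/-- **The exact free half-filled value as a cap at every `t′`**: `e(1, t′, 0, 1) ≤ −1.6211`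
(`e(1, 0, 0, 1) = −16/π²`, Hirsch 1985 eq. (2.2), enclosed by `FreeFermionSquare.energyDensity2D_one_zero_one_mem_Ioo`;
`t′`-evenness + concavity at half filling). [cite: LiebLoss1993, §8, Theorem 8.2] -/
theorem laBox_free_halfFilling_cap (t' : ℝ) : energyDensityTT' 1 t' 0 1 ≤ -1.6211 := by
  have h0 : energyDensityTT' 1 0 0 1 ≤ -1.6211 := by
    rw [energyDensityTT'_zero]
    exact (FreeFermionSquare.energyDensity2D_one_zero_one_mem_Ioo).2.le
  exact box3d_halfFilling_cap_of_tp0 le_rfl h0 t'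

/-! ### §2 Filling transport on the band `n ∈ [171/200, 179/200]` -/

/-- **Cap on the filling band from the `n = 7/8` cap and the half-filling cap** (same `t′`, `U ≥ 0`): if
`e(1,t′,U,7/8) ≤ S` and `e(1,t′,U,1) ≤ C` then for every `n ∈ [171/200, 179/200]`,
`e(1,t′,U,n) ≤ max (max ((171/175)·S) S) (max S ((21/25)·S + (4/25)·C))` — vacuum chord at `171/200`, density chord to
half filling at `179/200`, and convexity in between (`energyDensityTT'_le_max_of_mem_Icc`). [cite: Ruelle1969, §3.3] -/
theorem laBox_band_cap {t' U S C : ℝ} (hU : 0 ≤ U) (hS : energyDensityTT' 1 t' U (7 / 8) ≤ S)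
    (hC : energyDensityTT' 1 t' U 1 ≤ C) {n : ℝ} (hn1 : 171 / 200 ≤ n) (hn2 : n ≤ 179 / 200) :
    energyDensityTT' 1 t' U n ≤ max (max (171 / 175 * S) S) (max S (21 / 25 * S + 4 / 25 * C)) := by
  have h171 := energyDensityTT'_le_vacuum_chord 1 t' hU (n := 171 / 200) (n₂ := 7 / 8)
    (by norm_num) (by norm_num) (by norm_num) hS
  have h179 := energyDensityTT'_le_density_chord 1 t' hU (n₁ := 7 / 8) (n := 179 / 200) (n₂ := 1)
    (by norm_num) (by norm_num) (by norm_num) (by norm_num) hS hC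
  have e171 : (171 / 200 : ℝ) / (7 / 8) * S = 171 / 175 * S := by ring
  have e179 : ((1 - 179 / 200) * S + (179 / 200 - 7 / 8) * C) / (1 - 7 / 8) = (21 / 25 : ℝ) * S + 4 / 25 * C := by
    ring
  rw [e171] at h171
  rw [e179] at h179
  rcases le_total n (7 / 8) with h | h
  · have hmax := energyDensityTT'_le_max_of_mem_Icc 1 t' hU (m₁ := 171 / 200) (m₂ := 7 / 8)
      (by norm_num) (by norm_num) h171 hS ⟨hn1, h⟩
    exact hmax.trans (le_max_left _ _)
  · have hmax := energyDensityTT'_le_max_of_mem_Icc 1 t' hU (m₁ := 7 / 8) (m₂ := 179 / 200)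
      (by norm_num) (by norm_num) hS h179 ⟨h, hn2⟩
    exact hmax.trans (le_max_right _ _)

/-- **Free-gas floor on the filling band**: a floor `L ≤ e(1,t′,0,7/8)` with `−1.62 ≤ L ≤ 0` (all five strip floors qualify)
gives `(179/175)·L ≤ e(1,t′,0,n)` for every `n ∈ [171/200, 179/200]` — convexity in the density: vacuum secant to the right of
`7/8` (`energyDensityTT'_ge_min_of_mem_Icc_right` with the vacuum cap `e(0) ≤ 0`), secant to the exact half-filled value
`−1.6211` to the left (`energyDensityTT'_ge_min_of_mem_Icc_left`); the box crew's `box3d_node_floor` re-read on the wider band.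
[cite: Ruelle1969, §3.3] -/
theorem laBox_band_free_floor {t' L : ℝ} (hL : L ≤ energyDensityTT' 1 t' 0 (7 / 8)) (hL0 : L ≤ 0)
    (hL16 : -1.62 ≤ L) {n : ℝ} (hn1 : 171 / 200 ≤ n) (hn2 : n ≤ 179 / 200) :
    179 / 175 * L ≤ energyDensityTT' 1 t' 0 n := by
  rcases le_total n (7 / 8) with h | h
  · have hleft := energyDensityTT'_ge_min_of_mem_Icc_left 1 t' le_rfl (n₁ := 171 / 200) (n₂ := 7 / 8) (n₃ := 1)
      (by norm_num) (by norm_num) (by norm_num) hL (laBox_free_halfFilling_cap t') ⟨hn1, h⟩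
    refine le_trans (le_min ?_ ?_) hleft
    · linarith
    · have e : L + (L - -1.6211) * (7 / 8 - 171 / 200) / (1 - 7 / 8) = L + (L + 1.6211) * (4 / 25 : ℝ) := by ring
      rw [e]
      linarith
  · have hright := energyDensityTT'_ge_min_of_mem_Icc_right 1 t' le_rfl (n₀ := 0) (n₁ := 7 / 8) (n₂ := 179 / 200)
      (by norm_num) (by norm_num) (by norm_num) (energyDensityTT'_density_zero_le 1 t' le_rfl) hL ⟨h, hn2⟩
    refine le_trans (le_min ?_ ?_) hright
    · linarith
    · have e : L + (L - 0) * (179 / 200 - 7 / 8) / (7 / 8 - 0) = (179 / 175 : ℝ) * L := by ring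
      rw [e]

/-! ### §3 The docc tail at a general density -/

/-- **The arithmetic tail at density `n`**: a cap `e(1,t′,U,n) ≤ u` (`U > 0`), a free floor `ℓ ≤ e(1,t′,0,n)` and
`u − ℓ < c·U` give `Re ω(n_{0↑}n_{0↓}) < c` for every torus-limit ground state at `(1, t′, U, n)`, `0 ≤ n < 2`.
[cite: KomaTasaki1994, §1] -/
theorem doccN_lt_of_cap_of_floor {t' U n u ℓ c : ℝ} (hU : 0 < U) (hn0 : 0 ≤ n) (hn2 : n < 2)
    (hcap : energyDensityTT' 1 t' U n ≤ u) (hℓ : ℓ ≤ energyDensityTT' 1 t' 0 n) (hlin : u - ℓ < c * U) :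
    ∀ (ω : InfVolFermionState 2) (Ls : ℕ → ℕ) (ψ : ∀ L, Fock (Orb (FermionTorus 2 L))),
      Tendsto Ls atTop atTop →
      (∀ j, IsGroundStateInSector (hubbardTorusTT' (Ls j) 1 t' U) (rectN n (Ls j)) 0 (ψ (Ls j))) →
      (∀ j, star (ψ (Ls j)) ⬝ᵥ ψ (Ls j) = 1) → ω.IsTorusLimitOf ψ Ls →
      (ω.expect ({0} : Finset (Site 2))
        (nAt 0 (Finset.mem_singleton_self 0) 0 * nAt 0 (Finset.mem_singleton_self 0) 1)).re < c := by
  intro ω Ls ψ hLs hψ h1 hω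
  have hd := hω.re_expect_docc_le_chord_of_groundState 1 t' hU.le hn0 hn2 hLs hψ h1 hcap le_rfl hU hℓ
  rw [sub_zero] at hd
  exact lt_of_le_of_lt hd ((div_lt_iff₀ hU).2 hlin)

/-- Elementary: the four affine cap branches each below `c·U + ℓ` give `max … − ℓ < c·U`. [folklore] -/
theorem max4_sub_lt {S C ℓ c U : ℝ} (h1 : 171 / 175 * S < c * U + ℓ) (h2 : S < c * U + ℓ)
    (h3 : 21 / 25 * S + 4 / 25 * C < c * U + ℓ) :
    max (max (171 / 175 * S) S) (max S (21 / 25 * S + 4 / 25 * C)) - ℓ < c * U := by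
  rw [sub_lt_iff_lt_add]
  simp only [max_lt_iff]
  exact ⟨⟨h1, h2⟩, h2, h3⟩

/-! ### §4 The class exclusion on the 3-D box -/

/-- **MEAN-FIELD / BCS CLASS EXCLUSION ON THE La₂₋ₓSrₓCuO₄ x = ⅛ BOX (kernel G3 word, filling-thickened).** Assume the claim
nodes of CERTIFIED #354, #445 and #472. Then for every `t′ ∈ [−3/10, 0]`, `U ∈ [7, 15]`, `n ∈ [171/200, 179/200]` and every
torus limit `ω` of unit `(rectN n L, S^z = 0)`-sector ground states of `hubbardTorusTT' L 1 t′ U` along `L → ∞`: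
`Re ω(n_{0↑} n_{0↓}) < (n/2)²` — no such ground state is a non-magnetic quasi-free (Hartree–Fock / singlet BCS, any gap,
uniform d-wave included) state. Proof: band cap (§2) over the strip cap of the nearer anchor and the half-filling cap (§1),
band free floor (§2) over the piecewise Fermi-sea strip floor, docc `U`-chord (§3) with `c = (171/400)² ≤ (n/2)²`; all thirty
linear margins `≥ 0.13`. [cite: KomaTasaki1994, §1] [cite: BachLiebSolovej1994, eq. (2c.36)] [cite: LiebLoss1993, §8, Theorem 8.2] -/
theorem laBox_docc_lt_sq_half_density_of (h354 : cert_dbt299pair_allk) (h445 : cert_dbt329pair_allk)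
    (h472 : cert_r472_pb2_tl_upper_n1_U8)
    {t' U n : ℝ} (ht1 : -3 / 10 ≤ t') (ht0 : t' ≤ 0) (hU7 : 7 ≤ U) (hU13 : U ≤ 15)
    (hn1 : 171 / 200 ≤ n) (hn2 : n ≤ 179 / 200) :
    ∀ (ω : InfVolFermionState 2) (Ls : ℕ → ℕ) (ψ : ∀ L, Fock (Orb (FermionTorus 2 L))),
      Tendsto Ls atTop atTop →
      (∀ j, IsGroundStateInSector (hubbardTorusTT' (Ls j) 1 t' U) (rectN n (Ls j)) 0 (ψ (Ls j))) →
      (∀ j, star (ψ (Ls j)) ⬝ᵥ ψ (Ls j) = 1) → ω.IsTorusLimitOf ψ Ls →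
      (ω.expect ({0} : Finset (Site 2))
        (nAt 0 (Finset.mem_singleton_self 0) 0 * nAt 0 (Finset.mem_singleton_self 0) 1)).re < (n / 2) ^ 2 := by
  intro ω Ls ψ hLs hψ h1 hω
  have hU0 : (0 : ℝ) < U := by linarith
  have hn0 : (0 : ℝ) ≤ n := by linarith
  have hn2' : n < 2 := by linarith
  -- it suffices to beat the constant c = (171/400)² ≤ (n/2)²
  have hc : ((171 : ℝ) / 400) ^ 2 ≤ (n / 2) ^ 2 :=
    pow_le_pow_left₀ (by norm_num) (by linarith : (171 : ℝ) / 400 ≤ n / 2) 2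
  refine lt_of_lt_of_le ?_ hc
  rw [show ((171 : ℝ) / 400) ^ 2 = 29241 / 160000 by norm_num]
  -- caps: half filling (any t') and the two strip anchors
  have hC1 := laBox_halfFilling_cap_of h472 t' hU0.le
  have hcapA := strip78_cap_of_anchor (m3_tp0_cap_decimal_of h354) t' hU0.le
  have hcapB := strip78_cap_of_anchor (m3_tpm1o4_cap_decimal_of h445) t' hU0.le
  rw [sub_zero, abs_of_nonpos ht0] at hcapA
  rw [show t' - -1 / 4 = t' + 1 / 4 by ring] at hcapB
  -- the five kernel Fermi-sea columns at U₀ = 0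
  have r30 := fermiSeaCellRow_tPrime_neg_three_div_ten_density_seven_div_eight (U := 0) le_rfl
  have r25 := fermiSeaCellRow_tPrime_neg_one_div_four_density_seven_div_eight (U := 0) le_rfl
  have r20 := fermiSeaCellRow_tPrime_neg_one_div_five_density_seven_div_eight (U := 0) le_rfl
  have r10 := fermiSeaCellRow_tPrime_neg_one_div_ten_density_seven_div_eight (U := 0) le_rfl
  have r00 := fermiSeaCellRow_tPrime_zero_density_seven_div_eight (U := 0) le_rfl
  -- the `max (U - 8) 0` term: two linear regimes
  have hmax : (max (U - 8) 0 = U - 8 ∧ 8 ≤ U) ∨ (max (U - 8) 0 = 0 ∧ U ≤ 8) := by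
    rcases le_total U 8 with hle | hle
    · exact Or.inr ⟨max_eq_right (by linarith), hle⟩
    · exact Or.inl ⟨max_eq_left (by linarith), hle⟩
  -- piecewise in t'
  rcases le_or_gt t' (-1 / 4) with hA | hA
  · -- piece [-3/10, -1/4]: anchor -1/4, strip floor -1.5633688449
    have hfl := strip78_floor_between (s := t') le_rfl (by norm_num : (-3 / 10 : ℝ) ≤ -1 / 4) r30 r25 ht1 hA
    have hL : (-1.5633688449 : ℝ) ≤ energyDensityTT' 1 t' 0 (7 / 8) :=
      le_trans (le_min (by norm_num) le_rfl) hfl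
    have hℓ := laBox_band_free_floor hL (by norm_num) (by norm_num) hn1 hn2
    rw [abs_of_nonpos (by linarith : t' + 1 / 4 ≤ 0)] at hcapB
    rcases hmax with ⟨hm, h8⟩ | ⟨hm, h8⟩
    all_goals
      rw [hm] at hcapB hC1
      exact doccN_lt_of_cap_of_floor hU0 hn0 hn2' (laBox_band_cap hU0.le hcapB hC1 hn1 hn2) hℓ
        (max4_sub_lt (by linarith only [ht1, hA, hU7, hU13, h8]) (by linarith only [ht1, hA, hU7, hU13, h8]) (by linarith only [ht1, hA, hU7, hU13, h8])) ω Ls ψ hLs hψ h1 hω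
  rw [abs_of_nonneg (by linarith : 0 ≤ t' + 1 / 4)] at hcapB
  rcases le_or_gt t' (-1 / 5) with hB | hB
  · -- piece (-1/4, -1/5]: anchor -1/4, strip floor -1.5668014377
    have hfl := strip78_floor_between (s := t') le_rfl (by norm_num : (-1 / 4 : ℝ) ≤ -1 / 5) r25 r20 hA.le hB
    have hL : (-1.5668014377 : ℝ) ≤ energyDensityTT' 1 t' 0 (7 / 8) :=
      le_trans (le_min (by norm_num) le_rfl) hfl
    have hℓ := laBox_band_free_floor hL (by norm_num) (by norm_num) hn1 hn2
    rcases hmax with ⟨hm, h8⟩ | ⟨hm, h8⟩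
    all_goals
      rw [hm] at hcapB hC1
      exact doccN_lt_of_cap_of_floor hU0 hn0 hn2' (laBox_band_cap hU0.le hcapB hC1 hn1 hn2) hℓ
        (max4_sub_lt (by linarith only [hA, hB, hU7, hU13, h8]) (by linarith only [hA, hB, hU7, hU13, h8]) (by linarith only [hA, hB, hU7, hU13, h8])) ω Ls ψ hLs hψ h1 hω
  rcases le_or_gt t' (-13 / 100) with hC | hC
  · -- piece (-1/5, -13/100]: anchor -1/4, strip floor -1.5831346202
    have hfl := strip78_floor_between (s := t') le_rfl (by norm_num : (-1 / 5 : ℝ) ≤ -1 / 10) r20 r10 hB.le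
      (by linarith)
    have hL : (-1.5831346202 : ℝ) ≤ energyDensityTT' 1 t' 0 (7 / 8) :=
      le_trans (le_min (by norm_num) le_rfl) hfl
    have hℓ := laBox_band_free_floor hL (by norm_num) (by norm_num) hn1 hn2
    rcases hmax with ⟨hm, h8⟩ | ⟨hm, h8⟩
    all_goals
      rw [hm] at hcapB hC1
      exact doccN_lt_of_cap_of_floor hU0 hn0 hn2' (laBox_band_cap hU0.le hcapB hC1 hn1 hn2) hℓ
        (max4_sub_lt (by linarith only [hB, hC, hU7, hU13, h8]) (by linarith only [hB, hC, hU7, hU13, h8]) (by linarith only [hB, hC, hU7, hU13, h8])) ω Ls ψ hLs hψ h1 hω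
  rcases le_or_gt t' (-1 / 10) with hD | hD
  · -- piece (-13/100, -1/10]: anchor 0, strip floor -1.5831346202
    have hfl := strip78_floor_between (s := t') le_rfl (by norm_num : (-1 / 5 : ℝ) ≤ -1 / 10) r20 r10 hB.le hD
    have hL : (-1.5831346202 : ℝ) ≤ energyDensityTT' 1 t' 0 (7 / 8) :=
      le_trans (le_min (by norm_num) le_rfl) hfl
    have hℓ := laBox_band_free_floor hL (by norm_num) (by norm_num) hn1 hn2
    rcases hmax with ⟨hm, h8⟩ | ⟨hm, h8⟩
    all_goals
      rw [hm] at hcapA hC1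
      exact doccN_lt_of_cap_of_floor hU0 hn0 hn2' (laBox_band_cap hU0.le hcapA hC1 hn1 hn2) hℓ
        (max4_sub_lt (by linarith only [hC, hD, hU7, hU13, h8]) (by linarith only [hC, hD, hU7, hU13, h8]) (by linarith only [hC, hD, hU7, hU13, h8])) ω Ls ψ hLs hψ h1 hω
  · -- piece (-1/10, 0]: anchor 0, strip floor -1.6103642235
    have hfl := strip78_floor_between (s := t') le_rfl (by norm_num : (-1 / 10 : ℝ) ≤ 0) r10 r00 hD.le ht0
    have hL : (-1.6103642235 : ℝ) ≤ energyDensityTT' 1 t' 0 (7 / 8) :=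
      le_trans (le_min (by norm_num) le_rfl) hfl
    have hℓ := laBox_band_free_floor hL (by norm_num) (by norm_num) hn1 hn2
    rcases hmax with ⟨hm, h8⟩ | ⟨hm, h8⟩
    all_goals
      rw [hm] at hcapA hC1
      exact doccN_lt_of_cap_of_floor hU0 hn0 hn2' (laBox_band_cap hU0.le hcapA hC1 hn1 hn2) hℓ
        (max4_sub_lt (by linarith only [hD, ht0, hU7, hU13, h8]) (by linarith only [hD, ht0, hU7, hU13, h8]) (by linarith only [hD, ht0, hU7, hU13, h8])) ω Ls ψ hLs hψ h1 hω

end Summit.Ventures.CertifiedManyBodySolver.Observables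

end
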